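import Summits.Ventures.DiscreteObjects.Hadamard.PrimeOrderAutomorphism

/-!
# Hadamard 668 census, family F12 — fixed-point arithmetic of a prime-order automorphism, in the kernel (lemmas)

Framing: lottery ticket; floor = certified bounds/negative ranges.

Cell pub-namedobj (venture DiscreteObjects), target (H), hadamard gen 6.  General lemmas for a `0/1` incidence function
`N : P → B → ℤ` with an automorphism pair `(ρ, τ)` (`N (ρ x) (τ y) = N x y`, `ρ^p = τ^p = 1`, `p` prime), all derived inside
the kernel (no design theory, no parity theorem):
* `blockClasses τ p` = the `τ`-orbits of the moved blocks; they are disjoint `p`-sets covering the moved blocks, so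
  `#fixed blocks + p · #classes = |B|` (`card_fixed_add_classes`);
* a sum over the moved blocks of a class-constant function is divisible by `p` (`dvd_sum_moved`); hence a `ρ`-FIXED point with
  row sum `333` lies on `c` fixed blocks with `c + p a = 333` (`fixedPoint_row`), and two fixed points with inner product `166`
  share `u` fixed blocks with `u + p t = 166` (`fixedPair`); `0 ≤ u ≤ c ≤ #fixed blocks` (`fixedCount_bounds`, `pairCount_bounds`);
* `#fixed points ≡ |P| (mod p)` (`card_fixed_mod`, from Mathlib `Equiv.Perm.card_compl_support_modEq`);
* if `ρ` moves a point then `τ` moves a block (`exists_moved_block`, rows `333`/`166`);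
* **`orbitCount_cs`** (extracted from the proof of `no_automorphism_primes106`): with row sums `333`, distinct-row products `166`
  and a moved point, the number `m` of classes satisfies `1 ≤ m` and `(333 - σ)² ≤ m (167 + 166 p - p σ)` for an integer `σ`.
Used by `PrimeOrder17to47` to exclude the primes 17, 19, 31, 47.  Ours, not literature; no `sorry`.
-/

open Finset BigOperators

namespace Summit.Ventures.DiscreteObjects.Hadamard

section general
variable {P B : Type*} [Fintype P] [DecidableEq P] [Fintype B] [DecidableEq B]

omit [Fintype P] [DecidableEq P] [Fintype B] [DecidableEq B] in
/-- iterated compatibility of an automorphism pair -/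
lemma aut_pow_apply (N : P → B → ℤ) (ρ : Equiv.Perm P) (τ : Equiv.Perm B) (hN : ∀ x y, N (ρ x) (τ y) = N x y)
    (i : ℕ) (x : P) (y : B) : N ((ρ ^ i) x) ((τ ^ i) y) = N x y := by
  induction i generalizing x y with
  | zero => simp
  | succ i ih => rw [pow_succ', pow_succ', Equiv.Perm.mul_apply, Equiv.Perm.mul_apply, hN, ih]

omit [Fintype P] [DecidableEq P] [Fintype B] in
/-- a function constant along the `τ`-orbit of a moved point sums to `p` times its value -/
lemma sum_orbFin_const (τ : Equiv.Perm B) {p : ℕ} (hp : p.Prime) (hτ : τ ^ p = 1) {y₀ : B} (hy₀ : τ y₀ ≠ y₀)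
    (g : B → ℤ) (hg : ∀ i : ℕ, g ((τ ^ i) y₀) = g y₀) : ∑ y ∈ orbFin τ p y₀, g y = (p : ℤ) * g y₀ := by
  unfold orbFin
  rw [Finset.sum_image (fun i hi j hj h => perm_pow_apply_injective τ hp hτ hy₀ (Finset.mem_range.mp hi)
    (Finset.mem_range.mp hj) h)]
  rw [Finset.sum_congr rfl (fun i _ => hg i), Finset.sum_const, Finset.card_range, nsmul_eq_mul]

/-- the `τ`-orbits of the moved blocks -/
def blockClasses (τ : Equiv.Perm B) (p : ℕ) : Finset (Finset B) :=
  (univ.filter fun y => τ y ≠ y).image (orbFin τ p)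

/-- distinct classes are disjoint -/
lemma blockClasses_disjoint (τ : Equiv.Perm B) {p : ℕ} (hp : p.Prime) (hτ : τ ^ p = 1) :
    ((blockClasses τ p : Finset (Finset B)) : Set (Finset B)).PairwiseDisjoint id := by
  intro C hC C' hC' hne
  rw [Function.onFun, id, id, Finset.disjoint_left]
  intro y hy hy'
  apply hne
  obtain ⟨y₀, hy₀, rfl⟩ := Finset.mem_image.mp (Finset.mem_coe.mp hC)
  obtain ⟨y₁, hy₁, rfl⟩ := Finset.mem_image.mp (Finset.mem_coe.mp hC')
  rw [← orbFin_eq_of_mem τ hp hτ (Finset.mem_filter.mp hy₀).2 hy,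
    ← orbFin_eq_of_mem τ hp hτ (Finset.mem_filter.mp hy₁).2 hy']

/-- every class has `p` elements -/
lemma card_of_mem_blockClasses (τ : Equiv.Perm B) {p : ℕ} (hp : p.Prime) (hτ : τ ^ p = 1) {C : Finset B}
    (hC : C ∈ blockClasses τ p) : C.card = p := by
  obtain ⟨y₀, hy₀, rfl⟩ := Finset.mem_image.mp hC
  exact card_orbFin τ hp hτ (Finset.mem_filter.mp hy₀).2

/-- the classes cover exactly the moved blocks -/
lemma blockClasses_biUnion (τ : Equiv.Perm B) {p : ℕ} (hp : p.Prime) (hτ : τ ^ p = 1) :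
    (blockClasses τ p).biUnion id = univ.filter fun y => τ y ≠ y := by
  ext y
  rw [Finset.mem_biUnion, Finset.mem_filter]
  constructor
  · rintro ⟨C, hC, hy⟩
    obtain ⟨y₀, hy₀, rfl⟩ := Finset.mem_image.mp hC
    exact ⟨mem_univ _, moved_of_mem_orbFin τ hτ (Finset.mem_filter.mp hy₀).2 hy⟩
  · rintro ⟨-, hy⟩
    exact ⟨orbFin τ p y, Finset.mem_image_of_mem _ (Finset.mem_filter.mpr ⟨mem_univ _, hy⟩),
      mem_orbFin_self τ hp.pos y⟩

/-- **fixed blocks + p · (number of classes) = |B|** -/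
lemma card_fixed_add_classes (τ : Equiv.Perm B) {p : ℕ} (hp : p.Prime) (hτ : τ ^ p = 1) :
    (univ.filter fun y => τ y = y).card + (blockClasses τ p).card * p = Fintype.card B := by
  have h1 : ((blockClasses τ p).biUnion id).card = (blockClasses τ p).card * p := by
    rw [Finset.card_biUnion (blockClasses_disjoint τ hp hτ), Finset.sum_const_nat (m := p)]
    intro C hC; exact card_of_mem_blockClasses τ hp hτ hC
  rw [blockClasses_biUnion τ hp hτ] at h1
  rw [← h1, ← Finset.card_union_of_disjoint (Finset.disjoint_filter_filter_not _ _ _),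
    Finset.filter_union_filter_not_eq, Finset.card_univ]

/-- a sum over the moved blocks of a function that is constant along every class is divisible by `p` -/
lemma dvd_sum_moved (τ : Equiv.Perm B) {p : ℕ} (hp : p.Prime) (hτ : τ ^ p = 1) (g : B → ℤ)
    (hg : ∀ y₀, τ y₀ ≠ y₀ → ∀ i : ℕ, g ((τ ^ i) y₀) = g y₀) :
    (p : ℤ) ∣ ∑ y ∈ univ.filter (fun y => τ y ≠ y), g y := by
  rw [← blockClasses_biUnion τ hp hτ, Finset.sum_biUnion (blockClasses_disjoint τ hp hτ)]
  apply Finset.dvd_sum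
  intro C hC
  obtain ⟨y₀, hy₀, rfl⟩ := Finset.mem_image.mp hC
  have hy₀' := (Finset.mem_filter.mp hy₀).2
  rw [id, sum_orbFin_const τ hp hτ hy₀' g (hg y₀ hy₀')]
  exact dvd_mul_right _ _

omit [Fintype P] [DecidableEq P] in
/-- **Fixed point, single.** A `ρ`-fixed point `x` with row sum `333` lies on `c` fixed blocks with `c + p a = 333`. -/
lemma fixedPoint_row (N : P → B → ℤ) (hrow : ∀ x, ∑ y, N x y = 333) {p : ℕ} (hp : p.Prime)
    (ρ : Equiv.Perm P) (τ : Equiv.Perm B) (hN : ∀ x y, N (ρ x) (τ y) = N x y) (hτ : τ ^ p = 1)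
    {x : P} (hx : ρ x = x) :
    ∃ a : ℤ, (∑ y ∈ univ.filter (fun y => τ y = y), N x y) + p * a = 333 := by
  have split := Finset.sum_filter_add_sum_filter_not (univ : Finset B) (fun y => τ y = y) (fun y => N x y)
  rw [hrow x] at split
  obtain ⟨a, ha⟩ := dvd_sum_moved τ hp hτ (fun y => N x y) (by
    intro y₀ _ i
    show N x ((τ ^ i) y₀) = N x y₀
    conv_lhs => rw [← perm_pow_apply_of_fixed ρ hx i]
    exact aut_pow_apply N ρ τ hN i x y₀)
  refine ⟨a, ?_⟩
  have : (univ.filter fun y => ¬ τ y = y) = univ.filter fun y => τ y ≠ y := rfl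
  rw [this, ha] at split
  exact split

omit [Fintype P] [DecidableEq P] in
/-- **Fixed points, pair.** Two `ρ`-fixed points with inner product `166` lie on `u` common fixed blocks, `u + p t = 166`. -/
lemma fixedPair (N : P → B → ℤ) {p : ℕ} (hp : p.Prime)
    (ρ : Equiv.Perm P) (τ : Equiv.Perm B) (hN : ∀ x y, N (ρ x) (τ y) = N x y) (hτ : τ ^ p = 1)
    {x x' : P} (hx : ρ x = x) (hx' : ρ x' = x') (h166 : ∑ y, N x y * N x' y = 166) :
    ∃ t : ℤ, (∑ y ∈ univ.filter (fun y => τ y = y), N x y * N x' y) + p * t = 166 := by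
  have split := Finset.sum_filter_add_sum_filter_not (univ : Finset B) (fun y => τ y = y) (fun y => N x y * N x' y)
  rw [h166] at split
  obtain ⟨t, ht⟩ := dvd_sum_moved τ hp hτ (fun y => N x y * N x' y) (by
    intro y₀ _ i
    show N x ((τ ^ i) y₀) * N x' ((τ ^ i) y₀) = N x y₀ * N x' y₀
    conv_lhs => rw [← perm_pow_apply_of_fixed ρ hx i, ← perm_pow_apply_of_fixed ρ hx' i]
    rw [aut_pow_apply N ρ τ hN i x y₀, aut_pow_apply N ρ τ hN i x' y₀])
  refine ⟨t, ?_⟩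
  have : (univ.filter fun y => ¬ τ y = y) = univ.filter fun y => τ y ≠ y := rfl
  rw [this, ht] at split
  exact split

omit [Fintype P] [DecidableEq P] in
/-- bounds for the fixed-block count of a point: `0 ≤ c ≤ #fixed blocks` -/
lemma fixedCount_bounds (N : P → B → ℤ) (h01 : ∀ x y, N x y = 0 ∨ N x y = 1) (τ : Equiv.Perm B) (x : P) :
    0 ≤ ∑ y ∈ univ.filter (fun y => τ y = y), N x y ∧
    ∑ y ∈ univ.filter (fun y => τ y = y), N x y ≤ ((univ.filter fun y => τ y = y).card : ℤ) := by
  constructor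
  · exact Finset.sum_nonneg fun y _ => by rcases h01 x y with h | h <;> simp [h]
  · have : ∑ y ∈ univ.filter (fun y => τ y = y), N x y ≤ ∑ y ∈ univ.filter (fun y => τ y = y), (1 : ℤ) :=
      Finset.sum_le_sum fun y _ => by rcases h01 x y with h | h <;> simp [h]
    simpa using this

omit [Fintype P] [DecidableEq P] in
/-- bounds for the common fixed-block count of two points: `0 ≤ u ≤ c` -/
lemma pairCount_bounds (N : P → B → ℤ) (h01 : ∀ x y, N x y = 0 ∨ N x y = 1) (τ : Equiv.Perm B) (x x' : P) :
    0 ≤ ∑ y ∈ univ.filter (fun y => τ y = y), N x y * N x' y ∧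
    ∑ y ∈ univ.filter (fun y => τ y = y), N x y * N x' y ≤ ∑ y ∈ univ.filter (fun y => τ y = y), N x y := by
  constructor
  · exact Finset.sum_nonneg fun y _ => by
      rcases h01 x y with h | h <;> rcases h01 x' y with h' | h' <;> simp [h, h']
  · exact Finset.sum_le_sum fun y _ => by
      rcases h01 x y with h | h <;> rcases h01 x' y with h' | h' <;> simp [h, h']

/-- the number of fixed points is `≡ |P| (mod p)` -/
lemma card_fixed_mod (ρ : Equiv.Perm P) {p : ℕ} (hp : p.Prime) (hρ : ρ ^ p = 1) :
    (univ.filter fun x => ρ x = x).card % p = Fintype.card P % p := by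
  haveI : Fact p.Prime := ⟨hp⟩
  have h := Equiv.Perm.card_compl_support_modEq (p := p) (n := 1) (σ := ρ) (by rw [pow_one]; exact hρ)
  have e : ρ.supportᶜ = univ.filter fun x => ρ x = x := by
    ext x; simp [Equiv.Perm.mem_support]
  rw [e] at h
  exact h

omit [Fintype P] [DecidableEq P] in
/-- if `ρ` moves a point then `τ` moves a block (rows `x₀`, `ρ x₀` would coincide, inner product `333 ≠ 166`) -/
lemma exists_moved_block (N : P → B → ℤ) (h01 : ∀ x y, N x y = 0 ∨ N x y = 1)
    (hrow : ∀ x, ∑ y, N x y = 333) (hpair : ∀ x x', x ≠ x' → ∑ y, N x y * N x' y = 166)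
    (ρ : Equiv.Perm P) (τ : Equiv.Perm B) (hN : ∀ x y, N (ρ x) (τ y) = N x y) {x₀ : P} (hx₀ : ρ x₀ ≠ x₀) :
    ∃ y, τ y ≠ y := by
  by_contra h
  have hτ : ∀ y, τ y = y := fun y => not_not.mp (not_exists.mp h y)
  have e : ∑ y, N (ρ x₀) y * N x₀ y = 166 := hpair _ _ hx₀
  have e' : ∀ y, N (ρ x₀) y * N x₀ y = N x₀ y := by
    intro y
    rw [← hτ y, hN, hτ y]
    rcases h01 x₀ y with h | h <;> simp [h]
  rw [Finset.sum_congr rfl (fun y _ => e' y), hrow] at e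
  norm_num at e

/-- **Orbit count by Cauchy–Schwarz** (extracted from `no_automorphism_primes106`): with `m` the number of `τ`-orbits of
moved blocks, `1 ≤ m`, and `(333 - σ)² ≤ m (167 + 166 p - p σ)` for some integer `σ`. -/
theorem orbitCount_cs (N : P → B → ℤ) (h01 : ∀ x y, N x y = 0 ∨ N x y = 1)
    (hrow : ∀ x, ∑ y, N x y = 333) (hpair : ∀ x x', x ≠ x' → ∑ y, N x y * N x' y = 166)
    (p : ℕ) (hp : p.Prime)
    (ρ : Equiv.Perm P) (τ : Equiv.Perm B) (hN : ∀ x y, N (ρ x) (τ y) = N x y)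
    (hρ : ρ ^ p = 1) (hτ : τ ^ p = 1) (x₀ : P) (hx₀ : ρ x₀ ≠ x₀) :
    1 ≤ (blockClasses τ p).card ∧
    ∃ σ : ℤ, (333 - σ) ^ 2 ≤ ((blockClasses τ p).card : ℤ) * (167 + 166 * (p : ℤ) - (p : ℤ) * σ) := by
  have hNi : ∀ i x y, N ((ρ ^ i) x) ((τ ^ i) y) = N x y := aut_pow_apply N ρ τ hN
  set O := orbFin ρ p x₀ with hOdef
  have hOcard : O.card = p := card_orbFin ρ hp hρ hx₀
  have hx₀O : x₀ ∈ O := mem_orbFin_self ρ hp.pos x₀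
  set T : Finset (Finset B) := blockClasses τ p with hTdef
  have hTdef' : T = (univ.filter (fun y => τ y ≠ y)).image (orbFin τ p) := rfl
  let cls : B → Option {C // C ∈ T} := fun y =>
    if h : τ y = y then none else some ⟨orbFin τ p y, Finset.mem_image_of_mem _ (Finset.mem_filter.mpr ⟨mem_univ _, h⟩)⟩
  have fib_none : univ.filter (fun y => cls y = none) = univ.filter (fun y => τ y = y) := by
    ext y; simp only [Finset.mem_filter, Finset.mem_univ, true_and, cls]
    by_cases h : τ y = y <;> simp [h]
  have fib_some : ∀ C : {C // C ∈ T}, univ.filter (fun y => cls y = some C) = C.1 := by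
    rintro ⟨C, hC⟩
    obtain ⟨y₀, hy₀, rfl⟩ := Finset.mem_image.mp hC
    have hy₀' : τ y₀ ≠ y₀ := (Finset.mem_filter.mp hy₀).2
    ext y
    simp only [Finset.mem_filter, Finset.mem_univ, true_and, cls]
    constructor
    · intro h
      by_cases hy : τ y = y
      · simp [hy] at h
      · simp only [hy, ↓reduceDIte, Option.some.injEq, Subtype.mk.injEq] at h
        rw [← h]; exact mem_orbFin_self τ hp.pos y
    · intro h
      have hy : τ y ≠ y := moved_of_mem_orbFin τ hτ hy₀' h
      simp only [hy, ↓reduceDIte, Option.some.injEq, Subtype.mk.injEq]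
      exact orbFin_eq_of_mem τ hp hτ hy₀' h
  have cls_moved : ∀ C : {C // C ∈ T}, ∃ y₀, τ y₀ ≠ y₀ ∧ C.1 = orbFin τ p y₀ := by
    rintro ⟨C, hC⟩
    obtain ⟨y₀, hy₀, rfl⟩ := Finset.mem_image.mp hC
    exact ⟨y₀, (Finset.mem_filter.mp hy₀).2, rfl⟩
  let w : {C // C ∈ T} → ℤ := fun C => ∑ y ∈ C.1, N x₀ y
  have hw : ∀ x ∈ O, ∀ C, ∑ y ∈ univ.filter (fun y => cls y = some C), N x y = w C := by
    intro x hx C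
    rw [fib_some C]
    obtain ⟨y₀, hy₀, hCeq⟩ := cls_moved C
    obtain ⟨i, hi, rfl⟩ := Finset.mem_image.mp hx
    show ∑ y ∈ C.1, N ((ρ ^ i) x₀) y = ∑ y ∈ C.1, N x₀ y
    rw [hCeq, ← image_pow_orbFin τ hp hτ hy₀ i, Finset.sum_image (fun a _ b _ h => (τ ^ i).injective h)]
    rw [image_pow_orbFin τ hp hτ hy₀ i]
    exact Finset.sum_congr rfl fun y _ => hNi i x₀ y
  have hw' : ∀ C y, cls y = some C → ∑ x ∈ O, N x y = w C := by
    intro C y hy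
    have hyC : y ∈ C.1 := by rw [← fib_some C]; exact Finset.mem_filter.mpr ⟨mem_univ _, hy⟩
    obtain ⟨y₀, hy₀, hCeq⟩ := cls_moved C
    have const : ∀ y' (i : ℕ), ∑ x ∈ O, N x ((τ ^ i) y') = ∑ x ∈ O, N x y' := by
      intro y' i
      rw [hOdef, ← image_pow_orbFin ρ hp hρ hx₀ i, Finset.sum_image (fun a _ b _ h => (ρ ^ i).injective h)]
      rw [image_pow_orbFin ρ hp hρ hx₀ i]
      exact Finset.sum_congr rfl fun x _ => hNi i x y'
    have eqcount : ∀ y' ∈ C.1, ∑ x ∈ O, N x y' = ∑ x ∈ O, N x y₀ := by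
      intro y' hy'
      rw [hCeq] at hy'
      obtain ⟨i, hi, rfl⟩ := Finset.mem_image.mp hy'
      exact const y₀ i
    have dc : ∑ y' ∈ C.1, ∑ x ∈ O, N x y' = ∑ x ∈ O, ∑ y' ∈ C.1, N x y' := Finset.sum_comm
    rw [Finset.sum_congr rfl eqcount, Finset.sum_const] at dc
    have hCcard : C.1.card = p := by rw [hCeq]; exact card_orbFin τ hp hτ hy₀
    have inner : ∀ x ∈ O, ∑ y' ∈ C.1, N x y' = w C := by
      intro x hx; rw [← fib_some C]; exact hw x hx C
    rw [Finset.sum_congr rfl inner, Finset.sum_const, hOcard, hCcard] at dc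
    rw [eqcount y hyC]
    have hp0 : (p : ℤ) ≠ 0 := by exact_mod_cast hp.ne_zero
    have : (p : ℤ) * ∑ x ∈ O, N x y₀ = (p : ℤ) * w C := by
      simpa [nsmul_eq_mul] using dc
    exact mul_left_cancel₀ hp0 this
  have hfix : ∀ y, cls y = none → N x₀ y = 1 → ∀ x ∈ O, N x y = 1 := by
    intro y hy h1 x hx
    have hyfix : τ y = y := by
      have : y ∈ univ.filter (fun y => cls y = none) := Finset.mem_filter.mpr ⟨mem_univ _, hy⟩
      rw [fib_none] at this; exact (Finset.mem_filter.mp this).2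
    obtain ⟨i, hi, rfl⟩ := Finset.mem_image.mp hx
    rw [← perm_pow_apply_of_fixed τ hyfix i, hNi]; exact h1
  obtain ⟨h1, h2⟩ := orbitRow_identities N h01 333 166 hrow hpair O p hOcard x₀ hx₀O cls w hw hw' hfix
    (∑ y ∈ univ.filter (fun y => cls y = none), N x₀ y) rfl
  set σ := ∑ y ∈ univ.filter (fun y => cls y = none), N x₀ y with hσdef
  have hmT : Fintype.card {C // C ∈ T} = T.card := Fintype.card_coe T
  -- Cauchy–Schwarz
  have cs := Finset.sum_mul_sq_le_sq_mul_sq (Finset.univ : Finset {C // C ∈ T}) w (fun _ => (1 : ℤ))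
  simp only [mul_one, one_pow, Finset.sum_const, Finset.card_univ, nsmul_eq_mul] at cs
  rw [hmT, h1] at cs
  have h2' : ∑ j, (w j) ^ 2 = 167 + 166 * (p : ℤ) - (p : ℤ) * σ := by linarith
  rw [h2'] at cs
  refine ⟨?_, σ, by linarith⟩
  -- m = 0 is impossible
  by_contra hm0
  push Not at hm0
  have hT0 : T = ∅ := Finset.card_eq_zero.mp (by omega)
  have hw0 : ∑ j, w j = 0 := by
    have : (Finset.univ : Finset {C // C ∈ T}) = ∅ := by
      rw [← Finset.card_eq_zero, Finset.card_univ, hmT, hT0, Finset.card_empty]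
    rw [this, Finset.sum_empty]
  have hw0' : ∑ j, (w j) ^ 2 = 0 := by
    have : (Finset.univ : Finset {C // C ∈ T}) = ∅ := by
      rw [← Finset.card_eq_zero, Finset.card_univ, hmT, hT0, Finset.card_empty]
    rw [this, Finset.sum_empty]
  rw [hw0] at h1; rw [hw0'] at h2
  have hp2 : (2 : ℤ) ≤ p := by exact_mod_cast hp.two_le
  nlinarith

end general

end Summit.Ventures.DiscreteObjects.Hadamard
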